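import Summits.CriticalPhenomena.PercolationContinuityZ3.Theses.PercLowPointHalfSpace
import Summits.CriticalPhenomena.PercolationContinuityZ3.Theorems.BoundaryTwoArmDecay.Negative.OneArmLowerBound
import Summits.CriticalPhenomena.PercolationContinuityZ3.Theorems.BoundaryTwoArmDecay.Negative.LoadBearing
import Literature.Probability.Percolation.HalfSpacePinnedPairs
import Literature.Probability.Percolation.SharpnessDCTProofs
import Mathlib.Analysis.SpecialFunctions.Pow.Real
import Mathlib.Analysis.Complex.Exponential

/-!
# Crux `PercLowPointHalfSpace.BoundaryTwoArmDecay` (stmt-CriticalPhenomena-0911), line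
# `staircase-bootstrap-floor-decoupling` — stub `stub_reach`

Helper file for the crux skeleton `Cruxes/BoundaryTwoArmDecay/Lines/staircase_bootstrap_floor_decoupling.lean`.
Proves EXACTLY the registered stub signature `stub_reach` (the REACH REDUCTION); lands with
`--supports stmt-CriticalPhenomena-0911`. No new definition: the vocabulary is the landed one
(`Negative.H`, `Negative.e`, `Negative.μ`, `Negative.E` of `BoundaryTwoArmDecay/Negative/`).

## The statement

With `P = P_{p_c(ℤ³)}`, `ℍ = {x | 0 ≤ x 0} = halfSpace 3`, `e = (0,1,0)`: given `A ≥ 1`, a polynomial slab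
crossover bound with exponent `A`
(`P(x ⟷ lateral sup-distance n inside the slab {|z 0| ≤ k}) ≤ C k^C exp(-n/(C k^A))`, `k ≥ 1`), and a
VERTICAL a-priori bound `P(kissV_n) ≤ C n^{-a}` (`kissV_n` = both `ℍ`-clusters of `0` and `e` meet level `n`
and `0 ↮_ℍ e`), then for every `b > 0` with `b·A < a` the crux event `E r` (both clusters reach
SUP-distance `r`, `0 ↮_ℍ e`) has `P(E r) ≤ C r^{-b}` for `r ≥ 1`.

## Proof

Put `θ = b/a ∈ (0, 1]` (indeed `θA < 1`), `h = ⌈r^θ⌉₊`, so `1 ≤ h ≤ r` and `r^θ ≤ h ≤ 2 r^θ`.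
INCLUSION `E r ⊆ kissV_h ∪ Thin_h(0) ∪ Thin_h(e)`: if both clusters meet level `h` we are in `kissV_h`;
otherwise, say `C_ℍ(0)` has no vertex at level `≥ h`, the open `ℍ`-path from `0` to the far vertex `y`
only visits vertices `v` with `0 ⟷_ℍ v`, hence `0 ≤ v 0 < h`: it runs inside the slab `{|z 0| ≤ h}`, and
`y` is laterally far (the far coordinate cannot be the vertical one since `y 0 < h ≤ r`).
BOUND: union bound; `h^{-a} ≤ (r^θ)^{-a} = r^{-b}`; and the thin term
`C h^C exp(-r/(C h^A)) ≤ C 2^C r^{θC} · N! (C 2^A)^N r^{-N(1-θA)} ≤ K r^{-b}` by `exp(-t) ≤ N!/t^N`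
(`Real.pow_div_factorial_le_exp`) with `N (1 - θA) ≥ θC + b` — elementary, no limits.
-/

noncomputable section

namespace Summit.CriticalPhenomena.PercolationContinuityZ3.Theorems.BoundaryTwoArmDecay

open MeasureTheory
open Literature.Probability.Percolation Literature.Probability.LatticeModels

namespace StubReach

open Negative (H e μ E)
open Literature.Probability.Percolation.DCT16 (pathIn_of_mem_openConnIn mem_openConnIn_of_pathIn)

/-! ### Paths confined by a property of the cluster -/

/-- A path inside `S` from `u` all of whose initial segments end in `T` is a path inside `T`. -/
theorem pathIn_restrict {V : Type*} {G : SimpleGraph V} {S T : Set V} {u v : V}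
    (h : PathIn G S u v) (hT : ∀ w, PathIn G S u w → w ∈ T) : PathIn G T u v := by
  obtain ⟨hu, hr⟩ := h
  refine ⟨hT u (PathIn.refl hu), ?_⟩
  induction hr with
  | refl => exact Relation.ReflTransGen.refl
  | @tail b c hub hbc ih => exact ih.tail ⟨hbc.1, hT c ⟨hu, hub.tail hbc⟩⟩

/-- If every vertex joined to `x` inside `S` lies in `T`, then `{x ⟷ y in S} ⊆ {x ⟷ y in T}` pointwise. -/
theorem openConnIn_restrict {V : Type*} {S T : Set V} {x y : V} {ω : BondConfig V}
    (h : ω ∈ openConnIn S x y) (hT : ∀ w, ω ∈ openConnIn S x w → w ∈ T) :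
    ω ∈ openConnIn T x y :=
  mem_openConnIn_of_pathIn (pathIn_restrict (pathIn_of_mem_openConnIn h)
    fun w hw => hT w (mem_openConnIn_of_pathIn hw))

/-- A half-space arm from a floor root `x` to sup-distance `r` whose `ℍ`-cluster has no vertex at level
`≥ m` (`m ≤ r`) is a lateral crossing of distance `r` inside the slab `{|z 0| ≤ m}`. -/
theorem thin_of_low {ω : BondConfig (Site 3)} {x y : Site 3} {r m : ℕ} (hx : x 0 = 0) (hmr : m ≤ r)
    (hfar : ∃ i : Fin 3, (r : ℤ) ≤ |y i - x i|) (hconn : ω ∈ openConnIn H x y)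
    (hlow : ¬ ∃ y : Site 3, (m : ℤ) ≤ y 0 ∧ ω ∈ openConnIn (halfSpace 3) x y) :
    ∃ y : Site 3, (r : ℤ) ≤ max |y 1 - x 1| |y 2 - x 2| ∧
      ω ∈ openConnIn {z : Site 3 | |z 0| ≤ (m : ℤ)} x y := by
  have hlow' : ∀ w, ω ∈ openConnIn H x w → w 0 < m := fun w hw => by
    by_contra hle
    exact hlow ⟨w, not_lt.1 hle, hw⟩
  refine ⟨y, ?_, openConnIn_restrict hconn fun w hw => ?_⟩
  · obtain ⟨i, hi⟩ := hfar
    have hy0 : 0 ≤ y 0 := hconn.2.1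
    have hym : y 0 < m := hlow' y hconn
    have hmr' : (m : ℤ) ≤ r := by exact_mod_cast hmr
    fin_cases i
    · exfalso
      simp only [Fin.zero_eta, hx, sub_zero, abs_of_nonneg hy0] at hi
      omega
    · exact le_max_of_le_left hi
    · exact le_max_of_le_right hi
  · have h0 : 0 ≤ w 0 := hw.2.1
    have h1 : w 0 < m := hlow' w hw
    show |w 0| ≤ (m : ℤ)
    rw [abs_of_nonneg h0]
    exact h1.le

/-- **Inclusion** `E r ⊆ kissV_m ∪ Thin_m(0) ∪ Thin_m(e)` for `m ≤ r` (sets written verbatim in the tree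
vocabulary of the registered signature). -/
theorem E_subset_union (r m : ℕ) (hmr : m ≤ r) :
    E r ⊆ {ω | (∃ y : Site 3, (m : ℤ) ≤ y 0 ∧ ω ∈ openConnIn (halfSpace 3) 0 y) ∧
        (∃ y : Site 3, (m : ℤ) ≤ y 0 ∧ ω ∈ openConnIn (halfSpace 3) ((0 : Site 3) + Pi.single 1 1) y) ∧
        ω ∉ openConnIn (halfSpace 3) 0 ((0 : Site 3) + Pi.single 1 1)} ∪
      {ω | ∃ y : Site 3, (r : ℤ) ≤ max |y 1 - (0 : Site 3) 1| |y 2 - (0 : Site 3) 2| ∧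
        ω ∈ openConnIn {z : Site 3 | |z 0| ≤ (m : ℤ)} 0 y} ∪
      {ω | ∃ y : Site 3, (r : ℤ) ≤ max |y 1 - e 1| |y 2 - e 2| ∧
        ω ∈ openConnIn {z : Site 3 | |z 0| ≤ (m : ℤ)} e y} := by
  rintro ω ⟨⟨y, hyfar, hy⟩, ⟨y', hyfar', hy'⟩, hne⟩
  have he0 : (0 : Site 3) + Pi.single 1 1 = e := zero_add _
  by_cases h0 : ∃ y : Site 3, (m : ℤ) ≤ y 0 ∧ ω ∈ openConnIn (halfSpace 3) 0 y
  · by_cases h1 : ∃ y : Site 3, (m : ℤ) ≤ y 0 ∧ ω ∈ openConnIn (halfSpace 3) e y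
    · refine Or.inl (Or.inl ⟨h0, ?_, ?_⟩)
      · rw [he0]
        exact h1
      · rw [he0]
        exact hne
    · exact Or.inr (thin_of_low (by simp [e]) hmr hyfar' hy' h1)
  · have hyfar0 : ∃ i : Fin 3, (r : ℤ) ≤ |y i - (0 : Site 3) i| := by simpa using hyfar
    exact Or.inl (Or.inr (thin_of_low rfl hmr hyfar0 hy h0))

/-- Union bound over three events. -/
theorem measureReal_le_add₃ {α : Type*} {_ : MeasurableSpace α} {ν : Measure α} [IsFiniteMeasure ν]
    {s t₁ t₂ t₃ : Set α} (h : s ⊆ t₁ ∪ t₂ ∪ t₃) :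
    ν.real s ≤ ν.real t₁ + ν.real t₂ + ν.real t₃ :=
  calc ν.real s ≤ ν.real (t₁ ∪ t₂ ∪ t₃) := measureReal_mono h
    _ ≤ ν.real (t₁ ∪ t₂) + ν.real t₃ := measureReal_union_le _ _
    _ ≤ ν.real t₁ + ν.real t₂ + ν.real t₃ := add_le_add (measureReal_union_le _ _) le_rfl

/-! ### Elementary real analysis -/

/-- `exp(-t) ≤ N!/t^N` for `t > 0` (from `t^N/N! ≤ exp t`). -/
theorem exp_neg_le_factorial_div_pow (N : ℕ) {t : ℝ} (ht : 0 < t) :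
    Real.exp (-t) ≤ (N.factorial : ℝ) / t ^ N := by
  have h := Real.pow_div_factorial_le_exp t ht.le N
  have hpos : 0 < t ^ N / (N.factorial : ℝ) := by positivity
  rw [Real.exp_neg]
  calc (Real.exp t)⁻¹ ≤ (t ^ N / (N.factorial : ℝ))⁻¹ := inv_anti₀ hpos h
    _ = (N.factorial : ℝ) / t ^ N := inv_div _ _

/-- For `r ≥ 1` and `0 < θ ≤ 1`, the integer `h = ⌈r^θ⌉₊` satisfies `1 ≤ h ≤ r` and `r^θ ≤ h ≤ 2 r^θ`. -/
theorem natCeil_rpow_bounds {r : ℕ} (hr : 1 ≤ r) {θ : ℝ} (hθ : 0 < θ) (hθ1 : θ ≤ 1) :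
    1 ≤ ⌈(r : ℝ) ^ θ⌉₊ ∧ ⌈(r : ℝ) ^ θ⌉₊ ≤ r ∧ (r : ℝ) ^ θ ≤ ((⌈(r : ℝ) ^ θ⌉₊ : ℕ) : ℝ) ∧
      ((⌈(r : ℝ) ^ θ⌉₊ : ℕ) : ℝ) ≤ 2 * (r : ℝ) ^ θ := by
  have hr1 : (1 : ℝ) ≤ r := by exact_mod_cast hr
  have hs1 : 1 ≤ (r : ℝ) ^ θ := Real.one_le_rpow hr1 hθ.le
  refine ⟨Nat.one_le_ceil_iff.2 (by linarith), ?_, Nat.le_ceil _, ?_⟩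
  · refine Nat.ceil_le.2 ?_
    calc (r : ℝ) ^ θ ≤ (r : ℝ) ^ (1 : ℝ) := Real.rpow_le_rpow_of_exponent_le hr1 hθ1
      _ = r := Real.rpow_one _
  · have := Nat.ceil_lt_add_one (by linarith : (0 : ℝ) ≤ (r : ℝ) ^ θ)
    linarith

/-- `⌈r^θ⌉₊^(-a) ≤ r^(-(θ a))` for `r > 0`, `a ≥ 0`. -/
theorem natCeil_rpow_neg_le {r θ a : ℝ} (hr : 0 < r) (ha : 0 ≤ a) :
    ((⌈r ^ θ⌉₊ : ℕ) : ℝ) ^ (-a) ≤ r ^ (-(θ * a)) := by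
  have hs : 0 < r ^ θ := Real.rpow_pos_of_pos hr θ
  calc ((⌈r ^ θ⌉₊ : ℕ) : ℝ) ^ (-a) ≤ (r ^ θ) ^ (-a) :=
        Real.rpow_le_rpow_of_nonpos hs (Nat.le_ceil _) (by linarith)
    _ = r ^ (-(θ * a)) := by rw [← Real.rpow_mul hr.le, mul_neg]

/-- **The thin term is superpolynomially small** (explicit constant): for `Cs > 0`, `0 < θ ≤ 1`, `θA < 1`,
`0 ≤ A` and any `b` there is `K ≥ 0` with `Cs h^Cs exp(-r/(Cs h^A)) ≤ K r^{-b}` for all `r ≥ 1`, `h = ⌈r^θ⌉₊`. -/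
theorem thin_term_le {A Cs θ : ℝ} (b : ℝ) (hA : 0 ≤ A) (hCs : 0 < Cs) (hθ : 0 < θ) (hθ1 : θ ≤ 1)
    (hθA : θ * A < 1) :
    ∃ K : ℝ, 0 ≤ K ∧ ∀ r : ℕ, 1 ≤ r →
      Cs * ((⌈(r : ℝ) ^ θ⌉₊ : ℕ) : ℝ) ^ Cs *
          Real.exp (-((r : ℝ) / (Cs * ((⌈(r : ℝ) ^ θ⌉₊ : ℕ) : ℝ) ^ A))) ≤ K * (r : ℝ) ^ (-b) := by
  obtain ⟨ε, hεdef⟩ : ∃ ε : ℝ, ε = 1 - θ * A := ⟨_, rfl⟩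
  have hεpos : 0 < ε := by rw [hεdef]; linarith
  obtain ⟨N, hN⟩ := exists_nat_ge ((θ * Cs + b) / ε)
  have hN' : θ * Cs + b ≤ N * ε := by rwa [div_le_iff₀ hεpos] at hN
  have h2A : (0 : ℝ) < 2 ^ A := Real.rpow_pos_of_pos (by norm_num) A
  have h2Cs : (0 : ℝ) < 2 ^ Cs := Real.rpow_pos_of_pos (by norm_num) Cs
  refine ⟨Cs * (2 : ℝ) ^ Cs * ((N.factorial : ℝ) * (Cs * (2 : ℝ) ^ A) ^ N), by positivity,
    fun r hr => ?_⟩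
  obtain ⟨-, -, hsh, hh2⟩ := natCeil_rpow_bounds hr hθ hθ1
  -- abbreviate `h = ⌈r^θ⌉₊` (as a real number)
  obtain ⟨h, hhdef⟩ : ∃ h : ℝ, h = ((⌈(r : ℝ) ^ θ⌉₊ : ℕ) : ℝ) := ⟨_, rfl⟩
  rw [← hhdef] at hsh hh2 ⊢
  have hr1 : (1 : ℝ) ≤ r := by exact_mod_cast hr
  have hr0 : (0 : ℝ) < r := by linarith
  have hs0 : 0 < (r : ℝ) ^ θ := Real.rpow_pos_of_pos hr0 θ
  have hh0 : 0 < h := lt_of_lt_of_le hs0 hsh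
  -- Step 1: `h^Cs ≤ 2^Cs r^(θ Cs)`
  have step1 : h ^ Cs ≤ (2 : ℝ) ^ Cs * (r : ℝ) ^ (θ * Cs) := by
    calc h ^ Cs ≤ (2 * (r : ℝ) ^ θ) ^ Cs := Real.rpow_le_rpow hh0.le hh2 hCs.le
      _ = (2 : ℝ) ^ Cs * ((r : ℝ) ^ θ) ^ Cs := Real.mul_rpow (by norm_num) hs0.le
      _ = (2 : ℝ) ^ Cs * (r : ℝ) ^ (θ * Cs) := by rw [Real.rpow_mul hr0.le]
  -- Step 2: `h^A ≤ 2^A r^(θ A)`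
  have step2 : h ^ A ≤ (2 : ℝ) ^ A * (r : ℝ) ^ (θ * A) := by
    calc h ^ A ≤ (2 * (r : ℝ) ^ θ) ^ A := Real.rpow_le_rpow hh0.le hh2 hA
      _ = (2 : ℝ) ^ A * ((r : ℝ) ^ θ) ^ A := Real.mul_rpow (by norm_num) hs0.le
      _ = (2 : ℝ) ^ A * (r : ℝ) ^ (θ * A) := by rw [Real.rpow_mul hr0.le]
  -- Step 3: the exponent `r/(Cs h^A) ≥ r^ε/(Cs 2^A)` (as `r = r^(θA) r^ε`)
  have hT0 : 0 < (r : ℝ) ^ ε / (Cs * 2 ^ A) := by positivity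
  have hsplit : (r : ℝ) ^ (θ * A) * (r : ℝ) ^ ε = r := by
    rw [← Real.rpow_add hr0, hεdef, add_sub_cancel, Real.rpow_one]
  have step3 : (r : ℝ) ^ ε / (Cs * 2 ^ A) ≤ (r : ℝ) / (Cs * h ^ A) := by
    rw [div_le_div_iff₀ (by positivity) (by positivity)]
    calc (r : ℝ) ^ ε * (Cs * h ^ A) ≤ (r : ℝ) ^ ε * (Cs * ((2 : ℝ) ^ A * (r : ℝ) ^ (θ * A))) := by
          gcongr
      _ = (r : ℝ) ^ (θ * A) * (r : ℝ) ^ ε * (Cs * 2 ^ A) := by ring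
      _ = (r : ℝ) * (Cs * 2 ^ A) := by rw [hsplit]
  -- Step 4: `exp(-r/(Cs h^A)) ≤ N! (Cs 2^A)^N r^(-(ε N))`
  have step4 : Real.exp (-((r : ℝ) / (Cs * h ^ A))) ≤
      (N.factorial : ℝ) * (Cs * (2 : ℝ) ^ A) ^ N * (r : ℝ) ^ (-(ε * N)) := by
    calc Real.exp (-((r : ℝ) / (Cs * h ^ A))) ≤ Real.exp (-((r : ℝ) ^ ε / (Cs * 2 ^ A))) :=
          Real.exp_le_exp.2 (neg_le_neg step3)
      _ ≤ (N.factorial : ℝ) / ((r : ℝ) ^ ε / (Cs * 2 ^ A)) ^ N := exp_neg_le_factorial_div_pow N hT0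
      _ = (N.factorial : ℝ) * (Cs * (2 : ℝ) ^ A) ^ N * (r : ℝ) ^ (-(ε * N)) := by
          rw [div_pow, Real.rpow_neg hr0.le, ← Real.rpow_natCast ((r : ℝ) ^ ε) N,
            ← Real.rpow_mul hr0.le]
          have hpos : 0 < (r : ℝ) ^ (ε * (N : ℝ)) := Real.rpow_pos_of_pos hr0 _
          field_simp
  -- Step 5: combine, `θ Cs - ε N ≤ -b`
  have hexp : θ * Cs + -(ε * N) ≤ -b := by linarith
  calc Cs * h ^ Cs * Real.exp (-((r : ℝ) / (Cs * h ^ A)))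
      ≤ Cs * ((2 : ℝ) ^ Cs * (r : ℝ) ^ (θ * Cs)) *
          ((N.factorial : ℝ) * (Cs * (2 : ℝ) ^ A) ^ N * (r : ℝ) ^ (-(ε * N))) :=
        mul_le_mul (mul_le_mul_of_nonneg_left step1 hCs.le) step4 (Real.exp_pos _).le (by positivity)
    _ = Cs * (2 : ℝ) ^ Cs * ((N.factorial : ℝ) * (Cs * (2 : ℝ) ^ A) ^ N) *
          ((r : ℝ) ^ (θ * Cs) * (r : ℝ) ^ (-(ε * N))) := by ring
    _ = Cs * (2 : ℝ) ^ Cs * ((N.factorial : ℝ) * (Cs * (2 : ℝ) ^ A) ^ N) *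
          (r : ℝ) ^ (θ * Cs + -(ε * N)) := by rw [← Real.rpow_add hr0]
    _ ≤ Cs * (2 : ℝ) ^ Cs * ((N.factorial : ℝ) * (Cs * (2 : ℝ) ^ A) ^ N) * (r : ℝ) ^ (-b) := by
        gcongr

end StubReach

open StubReach Negative in
/-- **STUB `stub_reach`** (registered signature, verbatim) — REACH REDUCTION: a polynomial slab crossover
bound with exponent `A ≥ 1` converts the VERTICAL a-priori exponent `a` of the kiss event into the
SUP-NORM exponent `b` of the crux event `E r`, for every `b > 0` with `b·A < a`. -/
theorem stub_reach :
    ∀ A : ℝ, 1 ≤ A →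
      (∃ C : ℝ, 0 < C ∧ ∀ k n : ℕ, 1 ≤ k → ∀ x : Site 3,
        (bondPercolation (zdGraph 3) (criticalProbI 3)).real
            {ω | ∃ y : Site 3, (n : ℤ) ≤ max |y 1 - x 1| |y 2 - x 2| ∧
              ω ∈ openConnIn {z : Site 3 | |z 0| ≤ (k : ℤ)} x y} ≤
          C * (k : ℝ) ^ C * Real.exp (-((n : ℝ) / (C * (k : ℝ) ^ A)))) →
      ∀ a b : ℝ, 0 < b → b * A < a →
        (∃ C : ℝ, ∀ n : ℕ, 1 ≤ n →
          (bondPercolation (zdGraph 3) (criticalProbI 3)).real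
              {ω | (∃ y : Site 3, (n : ℤ) ≤ y 0 ∧ ω ∈ openConnIn (halfSpace 3) 0 y) ∧
                (∃ y : Site 3, (n : ℤ) ≤ y 0 ∧ ω ∈ openConnIn (halfSpace 3) ((0 : Site 3) + Pi.single 1 1) y) ∧
                ω ∉ openConnIn (halfSpace 3) 0 ((0 : Site 3) + Pi.single 1 1)} ≤ C * (n : ℝ) ^ (-a)) →
        ∃ C : ℝ, ∀ r : ℕ, 1 ≤ r →
          (bondPercolation (zdGraph 3) (criticalProbI 3)).real
              {ω | (∃ y : Site 3, (∃ i : Fin 3, (r : ℤ) ≤ |y i|) ∧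
                    ω ∈ openConnIn {x : Site 3 | 0 ≤ x 0} 0 y) ∧
                  (∃ y : Site 3, (∃ i : Fin 3, (r : ℤ) ≤ |y i - (Pi.single 1 1 : Site 3) i|) ∧
                    ω ∈ openConnIn {x : Site 3 | 0 ≤ x 0} (Pi.single 1 1 : Site 3) y) ∧
                  ω ∉ openConnIn {x : Site 3 | 0 ≤ x 0} 0 (Pi.single 1 1 : Site 3)} ≤ C * (r : ℝ) ^ (-b) := by
  intro A hA hslab a b hb hbA hkiss
  obtain ⟨Cs, hCs, hslab⟩ := hslab
  obtain ⟨Ca, hkiss⟩ := hkiss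
  -- parameters
  have hba : b < a := by nlinarith [mul_le_mul_of_nonneg_left hA hb.le]
  have ha : 0 < a := hb.trans hba
  obtain ⟨θ, hθdef⟩ : ∃ θ : ℝ, θ = b / a := ⟨_, rfl⟩
  have hθ : 0 < θ := by rw [hθdef]; exact div_pos hb ha
  have hθA : θ * A < 1 := by rw [hθdef, div_mul_eq_mul_div, div_lt_one ha]; exact hbA
  have hθ1 : θ ≤ 1 := by
    have : θ ≤ θ * A := le_mul_of_one_le_right hθ.le hA
    linarith
  have hθa : θ * a = b := by rw [hθdef]; field_simp
  obtain ⟨K, -, hK⟩ := thin_term_le b (by linarith : (0 : ℝ) ≤ A) hCs hθ hθ1 hθA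
  refine ⟨max Ca 0 + 2 * K, fun r hr => ?_⟩
  obtain ⟨hh1, hhr, -, -⟩ := natCeil_rpow_bounds hr hθ hθ1
  have hr1 : (1 : ℝ) ≤ r := by exact_mod_cast hr
  have hr0 : (0 : ℝ) < r := by linarith
  -- the kiss term: `Ca h^(-a) ≤ max Ca 0 · r^(-b)`
  have kiss_le : Ca * ((⌈(r : ℝ) ^ θ⌉₊ : ℕ) : ℝ) ^ (-a) ≤ max Ca 0 * (r : ℝ) ^ (-b) := by
    calc Ca * ((⌈(r : ℝ) ^ θ⌉₊ : ℕ) : ℝ) ^ (-a) ≤ max Ca 0 * ((⌈(r : ℝ) ^ θ⌉₊ : ℕ) : ℝ) ^ (-a) :=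
          mul_le_mul_of_nonneg_right (le_max_left _ _) (Real.rpow_nonneg (Nat.cast_nonneg _) _)
      _ ≤ max Ca 0 * (r : ℝ) ^ (-b) := by
          refine mul_le_mul_of_nonneg_left ?_ (le_max_right _ _)
          have := natCeil_rpow_neg_le (θ := θ) hr0 ha.le
          rwa [hθa] at this
  -- union bound and assembly
  have step := (measureReal_le_add₃ (ν := μ) (E_subset_union r _ hhr)).trans
    (add_le_add (add_le_add (hkiss _ hh1) (hslab _ r hh1 0)) (hslab _ r hh1 e))
  have fin := step.trans (add_le_add (add_le_add kiss_le (hK r hr)) (hK r hr))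
  have final : μ.real (E r) ≤ (max Ca 0 + 2 * K) * (r : ℝ) ^ (-b) := fin.trans (le_of_eq (by ring))
  exact final

end Summit.CriticalPhenomena.PercolationContinuityZ3.Theorems.BoundaryTwoArmDecay
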